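import Summits.RiemannHypothesis.RiemannHypothesis.Theorems.TiltedLandingLaw421R3ClusterStep
import Summits.RiemannHypothesis.RiemannHypothesis.Theorems.TiltedLandingLaw421R3BotQ
import Summits.RiemannHypothesis.RiemannHypothesis.Theorems.TiltedLandingLaw421R2Ready
import Summits.RiemannHypothesis.RiemannHypothesis.Theorems.TiltedLandingLaw421StubAnalyticHeredity

/-!
# The ALL-IN-BAND WINDOW CASE for `stub_restSuccBotQ`

SUPPORT module for crux `TiltedLandingLaw421` (stmt-RiemannHypothesis-24774), `--supports … --as helper` only.

★ `noSucc_of_window_noNest`: If we have an all-in-band in-range Jensen window around a band state `v`, and there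
is NO successor at level `j+1`, then `ReadyR2` holds at level `j` — contradicting the `Charged` hypothesis.

This is BRANCH 2 (B1) of `stub_restSuccBotQ`: the case where there is an all-in-band in-range Jensen window
around the lowest band state, but no successor. By `tiltReady_of_window_noNest` from ClusterStep, if there is no
nested successor inside the window, then `TiltReady` holds. Since the hypotheses exclude nested successors (any
successor would contradict `hempty : ∀ u, ¬ StTrkDQ (j+1) u`), we get `TiltReady` → `ReadyR2` → contradiction.

The composition with Branch 1 and (B2) is done in the main stub file or in R3SuccResidual.

Typed ≠ proved; RH is NOT proved; 24774 OPEN.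
-/

set_option linter.dupNamespace false

namespace RhW08.SuccB

open Complex Set
open RhIdea6.G17.W07C7 RhIdea6.G17.W07C7.Rev6 RhIdea6.G18.W07C8.Law421BirthS RhIdea6.G19.W07C11.Seam
open RhIdea6.G20.W07C12.Frac RhIdea6.G20.W07C12.StColP RhW07.C12.FieldSplit RhIdea6.G21.W07C13.TentMax
open RhW07.C14.TwoSided RhW07.C14.Classes RhW07.C14.Lineage RhW07.C14.Booking
open RhW07.C13.Heredity RhIdea6.G22.W07C15pre.Injection RhW07.E3.Cell RhW07.E3.Lit
open RhW08.Round1 RhW08.StSwap RhW08.Round2 RhW08.QuadW RhW08.SealSwapQ RhW08.SealSwap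
open Summit.RiemannHypothesis.RiemannHypothesis.Theorems.Splittings.JensenWindow

/-- The ALL-IN-BAND IN-RANGE WINDOW conjunction: a Jensen window around the band state `v` with:
- `v` in the open window
- Every upper zero of `f^{(j)}` in the closed window is a band state with `Im ≤ Hs`
- The window base lies in range `x₀ ± (j+3)R/2`

This is the condition for (B1) to apply via clusterStep `tiltReady_of_window_noNest`. -/
def AllInBandInRangeWindow (f : ℂ → ℂ) (x₀ R Hs : ℝ) (j : ℕ) (v : ℂ) : Prop :=
  ∃ (α β h : ℝ), Window (iteratedDeriv j f) α β h ∧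
    v ∈ Ioo α β ×ℂ Ioo (-h) h ∧
    (∀ a : ℂ, iteratedDeriv j f a = 0 → 0 < a.im → a.re ∈ Icc α β → a.im ≤ h →
      (max (|a.re - x₀| - R / 2) 0) ^ 2 + (j : ℝ) * a.im ^ 2 ≤ (j : ℝ) * Hs ^ 2 ∧ a.im ≤ Hs) ∧
    x₀ - ((j : ℝ) + 3) * R / 2 < α ∧ β < x₀ + ((j : ℝ) + 3) * R / 2

/-- ★★ **BRANCH 2 (B1): WINDOW CASE**. If there is an all-in-band in-range Jensen window around a band state `v`
at level `j`, and there is NO successor at level `j+1`, then `ReadyR2` holds at level `j`.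

The proof uses `tiltReady_of_window_noNest` from ClusterStep:
- The window hypotheses are satisfied
- «No upper zero of `f^{(j+1)}` inside the window is nested under a band state of the closed window»:
  If there were such a nested successor `w`, then by `stColQ'_succ_of_window` it would be a `StColQ' (j+1)` state,
  contradicting `hempty`. So the hypothesis holds vacuously.
- The range hypothesis is part of `AllInBandInRangeWindow`
- Therefore `TiltReady` holds, hence `ReadyR2`. -/
theorem readyR2_of_window_noSucc {η : ℝ} {f : ℂ → ℂ} {x₀ s hmax R Hs : ℝ} {B j : ℕ} {v : ℂ}
    (hE : EngineHyps5 2 η f x₀ s hmax R Hs B)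
    (hv : StTrkDQ η f x₀ s hmax R Hs B j v)
    (hempty : ∀ u' : ℂ, ¬ StTrkDQ η f x₀ s hmax R Hs B (j + 1) u')
    (hW : AllInBandInRangeWindow f x₀ R Hs j v) :
    ReadyR2 η f x₀ s hmax R Hs B j v := by
  -- Unpack the window
  obtain ⟨α, β, h, hWin, hvmem, hband, hαlo, hβhi⟩ := hW
  -- Extract that f^{(j)} ≢ 0 from hv
  have hGne : iteratedDeriv j f ≠ 0 := hv.1
  -- Build the growth hypothesis for the RealEntireLt2 predicate
  -- EngineHyps5 gives us: diff at hE.1, real at hE.2.1, growth at hE.2.2.1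
  have hf : RealEntireLt2 f := by
    refine { diff := hE.1, real := hE.2.1, growth := ?_ }
    -- Extract growth from EngineHyps5: ∃ A' B' ρ : ℝ, ρ < 2 ∧ ∀ z : ℂ, ‖f z‖ ≤ A' * Real.exp (B' * ‖z‖ ^ ρ)
    obtain ⟨A', B', ρ, hρ, hgr⟩ := hE.2.2.1
    -- RealEntireLt2.growth wants: ∃ ρ C : ℝ, 0 ≤ ρ ∧ ρ < 2 ∧ ∀ z, ‖f z‖ ≤ C * Real.exp (‖z‖ ^ ρ)
    -- Use growth_treeForm and drop the extra 0 ≤ C' conjunct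
    obtain ⟨τ, C', hτ0, hτ2, _, hgr'⟩ := StubAnalyticHeredity.growth_treeForm hE.1 ⟨A', B', ρ, hρ, hgr⟩
    exact ⟨τ, C', hτ0, hτ2, hgr'⟩
  -- The existence of a couple inside the window: v is in the window and is a non-real zero
  have hJ : ∃ u ∈ Ioo α β ×ℂ Ioo (-h) h, iteratedDeriv j f u = 0 ∧ u.im ≠ 0 := by
    refine ⟨v, hvmem, hv.2.1, ?_⟩
    exact ne_of_gt hv.2.2.1
  -- The «no nested successor» hypothesis: for every band state `a` of the closed window, no upper zero `w` of
  -- `f^{(j+1)}` in the open window with 0 < w.im is nested under `a`. This is because if there were such a `w`,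
  -- it would be a successor state by `stColQ'_succ_of_window`, contradicting `hempty`.
  have hnoNest : ∀ a : ℂ, iteratedDeriv j f a = 0 → 0 < a.im → a.re ∈ Icc α β → a.im ≤ h →
      ∀ w ∈ Ioo α β ×ℂ Ioo (-h) h, iteratedDeriv (j + 1) f w = 0 → 0 < w.im → ¬ NestedStep a w := by
    intro a ha hapos hare hah w hw hfw hwpos hn
    -- If w is nested under a (a band state), then w is a successor
    -- Get band membership of a
    obtain ⟨hqa, haHs⟩ := hband a ha hapos hare hah
    -- Get that f^{(j+1)} ≢ 0
    have hne1 : iteratedDeriv (j + 1) f ≠ 0 := iteratedDeriv_succ_ne_zero_of_zero hE.1 j hGne hv.2.1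
    -- Build the successor state
    have hwband := band_step' hqa (sq_le_sq' (by linarith) haHs) hn
    have hwHs : w.im ≤ Hs := by
      unfold NestedStep at hn
      have h1 : w.im ^ 2 ≤ a.im ^ 2 := by nlinarith [sq_nonneg (w.re - a.re)]
      have hHs : 0 ≤ Hs := hE.2.2.2.2.2.2.2.1
      nlinarith [sq_nonneg (w.im - Hs), sq_nonneg (w.im + Hs)]
    have hw' : StColQ' η f x₀ s hmax R Hs B (j + 1) w := ⟨hne1, hfw, hwpos, by simp only [Nat.cast_add, Nat.cast_one] at hwband ⊢; exact hwband, hwHs⟩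
    -- StTrkDQ = StColQ', so hw' : StTrkDQ
    exact hempty w hw'
  -- The range hypothesis
  have hrange : ∀ c ∈ Ioo α β, |c - x₀| < ((j : ℝ) + 3) * R / 2 := by
    intro c hc
    rw [abs_lt]
    constructor <;> linarith [hc.1, hc.2]
  -- Apply tiltReady_of_window_noNest
  have htilt := (tiltReady_of_window_noNest hf hGne η s hmax B v hWin hJ hband hnoNest hrange).1
  -- TiltReady → ReadyR2 via cumReady_of_ready (ReadyR2 = CumReady WinOrTilt)
  exact (tiltReady_of_window_noNest hf hGne η s hmax B v hWin hJ hband hnoNest hrange).2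

end RhW08.SuccB
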